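import Mathlib.Analysis.Analytic.Binomial
import Mathlib.Analysis.SpecialFunctions.Integrals.Basic
import Mathlib.NumberTheory.Harmonic.Bounds
import Mathlib.MeasureTheory.Integral.Pi
import Mathlib.MeasureTheory.Integral.DominatedConvergence
import Literature.Barriers.CriticalPhenomena.RigorousRGSmallParameterSusceptibilityFormula
import HarnessLib

/-!
# `RigorousRGSmallParameter` (Slade, Theorem 1.4.1): Lemma 2.2.1 PROVED — `-(-Δ)^β` generates a
# long-range random walk on `ℤ^d`; the transcribed kernel is summable and Lemma 8.2.1 holds
# unconditionally

Companion of `RigorousRGSmallParameterSusceptibilityFormula.lean` (which vendored Slade's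
Lemma 2.2.1 as the named fact `LongRangePhi4.Slade2017_lem221` and proved Lemma 8.2.1 from it)
in the proof architecture of the barrier `RigorousRGSmallParameter.lean`. Source: G. Slade,
*Critical exponents for long-range `O(n)` models below the upper critical dimension*, CMP 358
(2018), arXiv:1611.06169, §2.1.1 and Lemma 2.2.1 (arXiv pp. 8–10).

## What the source prints

§2.1.1: "`-Δ = 2d(I - D)` with `D = J/2d`", `λ(k) = 2Σ_j(1 - cos k_j)`, and `(-Δ)^β` defined by
the Fourier integral `((-Δ)^β)_{x,y} = (2π)^{-d}∫_{[-π,π]^d} λ(k)^β e^{ik·(x-y)} dk` (transcribed as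
`fracLaplacianZd`, with `cos` since `λ` is even) — equivalently, for `β ∈ (0,1)`, by the binomial
series `(-Δ)^β = (2d)^β (I - J/2d)^β = (2d)^β Σ_{n≥0} (β choose n)(-1)ⁿ (J/2d)ⁿ`.
**Lemma 2.2.1.** "For `d ≥ 1` and `β ∈ (0,1)`, `(-Δ)^β_{x,x} > 0`, `(-Δ)^β_{x,y} < 0` if `x ≠ y`,
and `Σ_y (-Δ)^β_{x,y} = 0`." Printed proof: positivity of the diagonal "is clear from [the Fourier
integral] and the nonnegativity of `λ(k)`"; for `x ≠ y` "only terms with `n ≥ 1` contribute, and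
these terms are all nonpositive and not all are zero"; and
"`Σ_y (-Δ)^β_{x,y} = Σ_n (-1)ⁿ (β choose n) = (1 - 1)^β = 0`".

## What this file proves (everything; no named fact is introduced)

* `binomAlt β n = (-1)ⁿ (β choose n)` (Mathlib's `Ring.choose`) for `0 < β < 1`: the closed form
  `Σ_{n≤N} a_n = Π_{j≤N}(1 - β/j)` (`sum_range_binomAlt`), `a₀ = 1`, `a_n < 0` for `n ≥ 1`
  (`binomAlt_succ_neg`), `Σ|a_n| < ∞` (`summable_abs_binomAlt`, partial sums `1 - Π ≤ 1`) and
  **`Σ_n a_n = 0`** (`hasSum_binomAlt`: `Π_{j≤N}(1 - β/j) ≤ (N+1)^{-β} → 0`, via `1 - t ≤ e^{-t}`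
  and `log(N+1) ≤ H_N`), i.e. the printed "`(1-1)^β = 0`"; and the binomial series
  `(1 - μ)^β = Σ_n a_n μⁿ` for `|μ| < 1` (Mathlib's `Real.one_add_rpow_hasFPowerSeriesOnBall_zero`).
* `avgCos d k = μ(k) = d⁻¹Σ_j cos k_j` (the symbol of `D`), `λ = 2d(1 - μ)`
  (`laplaceSymbol_eq_avgCos`), `|μ| ≤ 1`, and `|μ(k)| < 1` for a.e. `k ∈ [-π,π]^d` (the
  exceptional set is the finite corner set `{0, ±π}^d`, `abs_avgCos_lt_one_ae`).
* `srwLaw d n = pₙ`, the `n`-step law of simple random walk, defined by the RECURSION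
  `p₀ = δ₀`, `p_{n+1}(x) = (2d)⁻¹Σ_j(pₙ(x+e_j) + pₙ(x-e_j))`: `pₙ ≥ 0`, `Σ_x pₙ(x) = 1`,
  `p₁(0) = 0`, `p_{|x|₁}(x) > 0`; and the Fourier identity
  `∫_{[-π,π]^d} μ(k)ⁿ cos(k·x) dk = (2π)^d pₙ(x)`
  (`setIntegral_avgCos_pow_mul_cos`, by induction, from the orthogonality of characters
  `∫_{[-π,π]^d} cos(k·x) dk = (2π)^d 𝟙{x=0}`, `setIntegral_cos_phase`, itself by Fubini over the
  product structure of Lebesgue measure on the cube and `∫_{-π}^{π} e^{imt}dt = 2π𝟙{m=0}`).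
* **`hasSum_fracLaplacianZd`**: `((-Δ)^β)_{x,y} = (2d)^β Σ_n a_n pₙ(x-y)` — the printed binomial
  expansion, entrywise, for the transcribed Fourier kernel (dominated convergence for series,
  bound `(2d)^β|a_n|`).
* **`Slade2017_lem221_holds : Slade2017_lem221`** — Lemma 2.2.1 discharged
  (`fracLaplacianZd_self_pos`: the series is `≥ β(2d)^β`; `fracLaplacianZd_neg`: all terms `≤ 0`
  and the term `n = |x-y|₁` is `< 0`; `hasSum_fracLaplacianZd_row`: Fubini for the absolutely
  summable double family `(n,y) ↦ (2d)^β a_n pₙ(x-y)`).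
* Consequences: `summable_abs_fracLaplacianZd` (rows of `(-Δ)^β` are absolutely summable — the
  summability that §2.2.2 takes from Lemma 2.1.1), `hasSum_fracLaplacianTorus` (the periodised
  torus kernel `fracLaplacianTorus` of the barrier file is a genuine sum, not a `tsum` junk
  value), `fracLaplacianTorus_rowSum` (`Σ_y((-Δ_Λ)^β)_{xy} = 0`, unconditionally), and
  **`Slade2017_lem821_unconditional`** — Lemma 8.2.1 for the transcribed model with no
  hypothesis beyond `d ≥ 1`, `α ∈ (0,2)`, `g > 0`, `m² > 0`.

Ledger effect: the trust base of `Slade2017_lem821_of_lem221` and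
`fracLaplacianTorus_rowSum_of_lem221` (sibling file) loses `Slade2017_lem221`, now a theorem; the
trust base of the barrier's reduction
chain (`Slade2017_criticalCurve`, `Slade2017_prop822`) is unchanged — the renormalisation-group
output is not touched. NOT proved here: the decay RATE `-(-Δ)^β_{0,x} ≍ |x|^{-d-2β}` of Lemma
2.1.1 (`Slade2017_lem211` stays a named fact; only summability is established), Lemma 2.2.2
(torus inverses), anything about `n = 0`.
-/

noncomputable section

namespace Literature.Barriers.CriticalPhenomena

open _root_.MeasureTheory Finset Filter Literature.Probability.LatticeModels
open scoped _root_.Topology BigOperators Nat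

namespace LongRangePhi4

/-! ### The binomial coefficients `(-1)ⁿ (β choose n)` for `0 < β < 1` -/

/-- Over `ℝ`, `Ring.choose a n = a(a-1)⋯(a-n+1)/n!`. [folklore] -/
theorem ring_choose_eq_prod_div (a : ℝ) (n : ℕ) :
    Ring.choose a n = (∏ j ∈ Finset.range n, (a - j)) / n ! := by
  rw [Ring.choose_eq_smul, smul_eq_mul, ← Polynomial.aeval_eq_smeval, Polynomial.aeval_def,
    Polynomial.eval₂_eq_eval_map, descPochhammer_map, descPochhammer_eval_eq_prod_range]
  rw [div_eq_inv_mul]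

/-- The alternating binomial coefficients `a_n = (-1)ⁿ (β choose n)` of `(1 - t)^β = Σ_n a_n tⁿ`.
[folklore] -/
def binomAlt (β : ℝ) (n : ℕ) : ℝ := (-1) ^ n * Ring.choose β n

/-- The partial products `P_N = Π_{j=1}^{N} (1 - β/j)`. [folklore] -/
def binomPartialProd (β : ℝ) (N : ℕ) : ℝ := ∏ j ∈ Finset.range N, (1 - β / (j + 1))

/-- `a₀ = 1`. [folklore] -/
theorem binomAlt_zero (β : ℝ) : binomAlt β 0 = 1 := by
  simp [binomAlt]

/-- `a_{N+1} = -(β/(N+1)) P_N`. [folklore] -/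
theorem binomAlt_succ (β : ℝ) (N : ℕ) :
    binomAlt β (N + 1) = -(β / (N + 1)) * binomPartialProd β N := by
  induction N with
  | zero =>
    simp [binomAlt, binomPartialProd]
  | succ N ih =>
    -- ratio of consecutive terms
    have hfac : ((N + 1 + 1)! : ℝ) = (N + 1 + 1) * (N + 1)! := by
      rw [Nat.factorial_succ]; push_cast; ring
    have h1 : binomAlt β (N + 1 + 1) = binomAlt β (N + 1) * ((N + 1 - β) / (N + 1 + 1)) := by
      simp only [binomAlt, ring_choose_eq_prod_div]
      rw [Finset.prod_range_succ, hfac]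
      have : ((N + 1)! : ℝ) ≠ 0 := by positivity
      field_simp
      push_cast
      ring
    have h2 : binomPartialProd β (N + 1) = binomPartialProd β N * (1 - β / (N + 1)) := by
      simp only [binomPartialProd]
      rw [Finset.prod_range_succ]
    rw [h1, ih, h2]
    have : (N : ℝ) + 1 ≠ 0 := by positivity
    have : (N : ℝ) + 1 + 1 ≠ 0 := by positivity
    field_simp
    push_cast
    ring

/-- `Σ_{n ≤ N} a_n = P_N`. [folklore] -/
theorem sum_range_binomAlt (β : ℝ) (N : ℕ) :
    ∑ n ∈ Finset.range (N + 1), binomAlt β n = binomPartialProd β N := by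
  induction N with
  | zero => simp [binomAlt_zero, binomPartialProd]
  | succ N ih =>
    rw [Finset.sum_range_succ, ih, binomAlt_succ]
    simp only [binomPartialProd]
    rw [Finset.prod_range_succ]
    ring

/-- The factors `1 - β/(j+1)` are positive for `β < 1`. [folklore] -/
theorem one_sub_div_succ_pos {β : ℝ} (hβ1 : β < 1) (j : ℕ) : 0 < 1 - β / ((j : ℝ) + 1) := by
  have hj : (1 : ℝ) ≤ j + 1 := by
    have : (0 : ℝ) ≤ j := Nat.cast_nonneg j
    linarith
  have : β / ((j : ℝ) + 1) < 1 := by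
    rw [div_lt_one (by linarith)]
    linarith
  linarith

/-- `0 < P_N` for `β < 1`. [folklore] -/
theorem binomPartialProd_pos {β : ℝ} (hβ1 : β < 1) (N : ℕ) : 0 < binomPartialProd β N :=
  Finset.prod_pos fun j _ => one_sub_div_succ_pos hβ1 j

/-- `P_N ≤ (N+1)^{-β}` for `0 ≤ β < 1` (`1 - t ≤ e^{-t}` and `log(N+1) ≤ H_N`). [folklore] -/
theorem binomPartialProd_le {β : ℝ} (hβ0 : 0 ≤ β) (hβ1 : β < 1) (N : ℕ) :
    binomPartialProd β N ≤ ((N : ℝ) + 1) ^ (-β) := by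
  -- `1 - t ≤ e^{-t}` factor by factor
  have h1 : binomPartialProd β N ≤ Real.exp (-(β * ∑ j ∈ Finset.range N, (1 : ℝ) / (j + 1))) := by
    unfold binomPartialProd
    rw [Finset.mul_sum, ← Finset.sum_neg_distrib, Real.exp_sum]
    refine Finset.prod_le_prod (fun j _ => (one_sub_div_succ_pos hβ1 j).le) fun j _ => ?_
    have := Real.add_one_le_exp (-(β * (1 / ((j : ℝ) + 1))))
    have e : (1 : ℝ) - β / (j + 1) = -(β * (1 / ((j : ℝ) + 1))) + 1 := by ring
    rw [e]
    exact this
  -- `log (N+1) ≤ H_N = Σ_{j<N} 1/(j+1)`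
  have h2 : Real.log ((N : ℝ) + 1) ≤ ∑ j ∈ Finset.range N, (1 : ℝ) / (j + 1) := by
    have := log_add_one_le_harmonic N
    simp only [harmonic] at this
    push_cast at this
    simpa only [one_div] using this
  have hN : (0 : ℝ) < N + 1 := by positivity
  calc binomPartialProd β N ≤ Real.exp (-(β * ∑ j ∈ Finset.range N, (1 : ℝ) / (j + 1))) := h1
    _ ≤ Real.exp (-(β * Real.log ((N : ℝ) + 1))) := by
        rw [Real.exp_le_exp, neg_le_neg_iff]
        exact mul_le_mul_of_nonneg_left h2 hβ0
    _ = ((N : ℝ) + 1) ^ (-β) := by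
        rw [Real.rpow_def_of_pos hN]
        congr 1
        ring

/-- For `0 < β < 1` all coefficients after the first are negative: `a_{N+1} < 0`. [folklore] -/
theorem binomAlt_succ_neg {β : ℝ} (hβ0 : 0 < β) (hβ1 : β < 1) (N : ℕ) : binomAlt β (N + 1) < 0 := by
  rw [binomAlt_succ]
  have h1 : 0 < β / ((N : ℝ) + 1) := by positivity
  have h2 := binomPartialProd_pos hβ1 N
  nlinarith

/-- `Σ_{n<N} |a_{n+1}| = 1 - P_N ≤ 1`. [folklore] -/
theorem sum_range_abs_binomAlt_succ {β : ℝ} (hβ0 : 0 < β) (hβ1 : β < 1) (N : ℕ) :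
    ∑ n ∈ Finset.range N, |binomAlt β (n + 1)| = 1 - binomPartialProd β N := by
  have h : ∀ n, |binomAlt β (n + 1)| = -binomAlt β (n + 1) := fun n =>
    abs_of_neg (binomAlt_succ_neg hβ0 hβ1 n)
  simp_rw [h]
  rw [Finset.sum_neg_distrib, ← sum_range_binomAlt, Finset.sum_range_succ', binomAlt_zero]
  ring

/-- The alternating binomial coefficients are absolutely summable (`0 < β < 1`). [folklore] -/
theorem summable_abs_binomAlt {β : ℝ} (hβ0 : 0 < β) (hβ1 : β < 1) :
    Summable fun n => |binomAlt β n| := by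
  have h : Summable fun n => |binomAlt β (n + 1)| := by
    refine summable_of_sum_range_le (c := 1) (fun n => abs_nonneg _) fun N => ?_
    rw [sum_range_abs_binomAlt_succ hβ0 hβ1]
    linarith [binomPartialProd_pos hβ1 N]
  exact (summable_nat_add_iff 1).1 h

/-- The alternating binomial coefficients are summable (`0 < β < 1`). [folklore] -/
theorem summable_binomAlt {β : ℝ} (hβ0 : 0 < β) (hβ1 : β < 1) : Summable (binomAlt β) :=
  (summable_abs_binomAlt hβ0 hβ1).of_abs

/-- `P_N → 0`. [folklore] -/
theorem tendsto_binomPartialProd {β : ℝ} (hβ0 : 0 < β) (hβ1 : β < 1) :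
    Tendsto (binomPartialProd β) atTop (𝓝 0) := by
  have h1 : Tendsto (fun N : ℕ => ((N : ℝ) + 1) ^ (-β)) atTop (𝓝 0) :=
    (tendsto_rpow_neg_atTop hβ0).comp
      (tendsto_natCast_atTop_atTop.atTop_add tendsto_const_nhds)
  exact tendsto_of_tendsto_of_tendsto_of_le_of_le tendsto_const_nhds h1
    (fun N => (binomPartialProd_pos hβ1 N).le) fun N => binomPartialProd_le hβ0.le hβ1 N

/-- **`Σ_n (-1)ⁿ (β choose n) = (1 - 1)^β = 0`** for `0 < β < 1` (the last display in the proof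
of Lemma 2.2.1), here from the closed form `Σ_{n≤N} a_n = Π_{j≤N}(1 - β/j) → 0`.
[cite: Slade2017, Lemma 2.2.1 (proof, last display)] -/
theorem hasSum_binomAlt {β : ℝ} (hβ0 : 0 < β) (hβ1 : β < 1) : HasSum (binomAlt β) 0 := by
  rw [(summable_binomAlt hβ0 hβ1).hasSum_iff_tendsto_nat]
  rw [← Filter.tendsto_add_atTop_iff_nat 1]
  simp_rw [sum_range_binomAlt]
  exact tendsto_binomPartialProd hβ0 hβ1

/-! ### The binomial series `(1 - μ)^β = Σ_n a_n μⁿ` for `|μ| < 1` -/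

/-- Mathlib's binomial series, unpacked: `(1 + t)^β = Σ_n (β choose n) tⁿ` for `|t| < 1`.
[folklore] -/
theorem hasSum_ring_choose_mul_pow (β : ℝ) {t : ℝ} (ht : |t| < 1) :
    HasSum (fun n => Ring.choose β n * t ^ n) ((1 + t) ^ β) := by
  have hmem : t ∈ Metric.eball (0 : ℝ) 1 := by
    rw [Metric.mem_eball, edist_dist, dist_zero_right, Real.norm_eq_abs, ENNReal.ofReal_lt_one]
    exact ht
  have h := (Real.one_add_rpow_hasFPowerSeriesOnBall_zero (a := β)).hasSum hmem
  have hfun : (fun n => (binomialSeries ℝ β n) fun _ => t) = fun n => Ring.choose β n * t ^ n := by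
    funext n
    rw [binomialSeries_apply, List.prod_ofFn, Fin.prod_const, smul_eq_mul]
  rw [hfun, zero_add] at h
  exact h

/-- `(1 - μ)^β = Σ_n (-1)ⁿ (β choose n) μⁿ` for `|μ| < 1`. [folklore] -/
theorem hasSum_binomAlt_mul_pow (β : ℝ) {μ : ℝ} (hμ : |μ| < 1) :
    HasSum (fun n => binomAlt β n * μ ^ n) ((1 - μ) ^ β) := by
  have h := hasSum_ring_choose_mul_pow β (t := -μ) (by rwa [abs_neg])
  have hfun : (fun n => Ring.choose β n * (-μ) ^ n) = fun n => binomAlt β n * μ ^ n := by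
    funext n
    rw [binomAlt, neg_pow μ n]
    ring
  rw [← sub_eq_add_neg, hfun] at h
  exact h

/-! ### The symbol `λ(k) = 2d(1 - μ(k))`, `μ(k) = d⁻¹Σ_j cos k_j` the symbol of `D = J/2d` -/

variable {d : ℕ}

/-- `μ(k) = d⁻¹ Σ_j cos k_j`, the Fourier symbol of the transition kernel `J/2d` of simple random
walk on `ℤ^d` (so that `λ(k) = 2d(1 - μ(k))`, i.e. `-Δ = 2d(I - J/2d)`).
[cite: Slade2017, Lemma 2.2.1 (proof: -Δ = 2d(I - J/2d))] -/
def avgCos (d : ℕ) (k : Fin d → ℝ) : ℝ := (∑ j, Real.cos (k j)) / d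

/-- `λ(k) = 2d(1 - μ(k))`. [cite: Slade2017, Lemma 2.2.1 (proof)] -/
theorem laplaceSymbol_eq_avgCos (hd : 1 ≤ d) (k : Fin d → ℝ) :
    laplaceSymbol k = 2 * d * (1 - avgCos d k) := by
  have hd' : (d : ℝ) ≠ 0 := by exact_mod_cast (Nat.one_le_iff_ne_zero.1 hd)
  unfold laplaceSymbol dispersion avgCos
  rw [Finset.sum_sub_distrib, Finset.sum_const, Finset.card_univ, Fintype.card_fin,
    nsmul_eq_mul, mul_one]
  field_simp

/-- `|μ(k)| ≤ 1`. [folklore] -/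
theorem abs_avgCos_le_one (k : Fin d → ℝ) : |avgCos d k| ≤ 1 := by
  unfold avgCos
  rcases Nat.eq_zero_or_pos d with hd | hd
  · subst hd
    simp
  · have hd' : (0 : ℝ) < d := by exact_mod_cast hd
    rw [abs_div, abs_of_pos hd', div_le_one hd']
    calc |∑ j, Real.cos (k j)| ≤ ∑ j, |Real.cos (k j)| := Finset.abs_sum_le_sum_abs _ _
      _ ≤ ∑ _j : Fin d, (1 : ℝ) := Finset.sum_le_sum fun j _ => Real.abs_cos_le_one _
      _ = d := by simp

/-- `μ` is continuous. [folklore] -/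
theorem continuous_avgCos : Continuous (avgCos d) := by
  unfold avgCos
  fun_prop

/-- On the Brillouin zone, `|μ(k)| = 1` only at the corners `k ∈ {0, π, -π}^d`: if
`Σ_j cos k_j = ±d` then every `cos k_j = ±1`. [folklore] -/
theorem mem_corner_of_abs_avgCos_eq_one (hd : 1 ≤ d) {k : Fin d → ℝ} (hk : k ∈ brillouin d)
    (h : ¬ |avgCos d k| < 1) :
    k ∈ Set.univ.pi fun _ : Fin d => ({0, Real.pi, -Real.pi} : Set ℝ) := by
  have hd' : (0 : ℝ) < d := by exact_mod_cast hd
  have h1 : |avgCos d k| = 1 := le_antisymm (abs_avgCos_le_one k) (not_lt.1 h)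
  have hkj : ∀ j, -Real.pi ≤ k j ∧ k j ≤ Real.pi := fun j => by
    have := hk j (Set.mem_univ j)
    exact ⟨this.1, this.2⟩
  simp only [Set.mem_pi, Set.mem_univ, true_implies, Set.mem_insert_iff, Set.mem_singleton_iff]
  intro j
  unfold avgCos at h1
  rw [abs_div, abs_of_pos hd', div_eq_one_iff_eq hd'.ne'] at h1
  rcases abs_eq (le_of_lt hd') |>.1 h1 with hsum | hsum
  · -- `Σ cos = d`: every `cos k_j = 1`, so `k_j = 0`
    left
    have hz : ∑ i, (1 - Real.cos (k i)) = 0 := by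
      rw [Finset.sum_sub_distrib, hsum]
      simp
    have hi := (Finset.sum_eq_zero_iff_of_nonneg fun i _ =>
      sub_nonneg.2 (Real.cos_le_one (k i))).1 hz j (Finset.mem_univ j)
    have hcos : Real.cos (k j) = 1 := by linarith
    exact (Real.cos_eq_one_iff_of_lt_of_lt (by linarith [(hkj j).1, Real.pi_pos])
      (by linarith [(hkj j).2, Real.pi_pos])).1 hcos
  · -- `Σ cos = -d`: every `cos k_j = -1`, so `k_j = ±π`
    right
    have hz : ∑ i, (1 + Real.cos (k i)) = 0 := by
      rw [Finset.sum_add_distrib, hsum]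
      simp
    have hi := (Finset.sum_eq_zero_iff_of_nonneg fun i _ => by
      linarith [Real.neg_one_le_cos (k i)]).1 hz j (Finset.mem_univ j)
    have hcos : Real.cos (k j) = -1 := by linarith
    rcases le_or_gt 0 (k j) with hpos | hneg
    · left
      have hc : Real.cos (k j - Real.pi) = 1 := by
        rw [Real.cos_sub_pi, hcos, neg_neg]
      have := (Real.cos_eq_one_iff_of_lt_of_lt (x := k j - Real.pi)
        (by linarith [Real.pi_pos]) (by linarith [(hkj j).2, Real.pi_pos])).1 hc
      linarith
    · right
      have hc : Real.cos (k j + Real.pi) = 1 := by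
        rw [Real.cos_add_pi, hcos, neg_neg]
      have := (Real.cos_eq_one_iff_of_lt_of_lt (x := k j + Real.pi)
        (by linarith [(hkj j).1, Real.pi_pos]) (by linarith [Real.pi_pos])).1 hc
      linarith

/-- The corner set has Lebesgue measure zero, so `|μ(k)| < 1` for a.e. `k` in the Brillouin zone.
[folklore] -/
theorem abs_avgCos_lt_one_ae (hd : 1 ≤ d) :
    ∀ᵐ k ∂(volume.restrict (brillouin d)), |avgCos d k| < 1 := by
  rw [ae_restrict_iff' (measurableSet_brillouin d), ae_iff]
  refine measure_mono_null (t := Set.univ.pi fun _ : Fin d => ({0, Real.pi, -Real.pi} : Set ℝ))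
    (fun k hk => ?_) ?_
  · simp only [Set.mem_setOf_eq, Classical.not_imp] at hk
    exact mem_corner_of_abs_avgCos_eq_one hd hk.1 hk.2
  · rw [volume_pi_pi]
    refine Finset.prod_eq_zero (Finset.mem_univ ⟨0, hd⟩) ?_
    exact (Set.toFinite _).measure_zero _

/-! ### The `n`-step law of simple random walk, by recursion -/

/-- The `n`-step transition function of simple random walk on `ℤ^d`, `pₙ(x) = ((J/2d)ⁿ)_{0,x}`,
defined by the recursion `p₀ = δ₀`, `p_{n+1}(x) = (2d)⁻¹ Σ_j (pₙ(x + e_j) + pₙ(x - e_j))` (so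
that no path counting is needed). [cite: Slade2017, Lemma 2.2.1 (proof: the matrix J/2d)] -/
def srwLaw (d : ℕ) : ℕ → Site d → ℝ
  | 0 => fun x => if x = 0 then 1 else 0
  | n + 1 => fun x =>
      (∑ j : Fin d, (srwLaw d n (x + Pi.single j 1) + srwLaw d n (x - Pi.single j 1))) / (2 * d)

/-- `p₀ = δ₀`. [folklore] -/
theorem srwLaw_zero_apply (x : Site d) : srwLaw d 0 x = if x = 0 then 1 else 0 := rfl

/-- `p_{n+1}(x) = (2d)⁻¹Σ_j(pₙ(x + e_j) + pₙ(x - e_j))`. [folklore] -/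
theorem srwLaw_succ_apply (n : ℕ) (x : Site d) :
    srwLaw d (n + 1) x =
      (∑ j : Fin d, (srwLaw d n (x + Pi.single j 1) + srwLaw d n (x - Pi.single j 1))) /
        (2 * d) := rfl

/-- `pₙ ≥ 0`. [folklore] -/
theorem srwLaw_nonneg (n : ℕ) (x : Site d) : 0 ≤ srwLaw d n x := by
  induction n generalizing x with
  | zero =>
    rw [srwLaw_zero_apply]
    split_ifs <;> norm_num
  | succ n ih =>
    rw [srwLaw_succ_apply]
    exact div_nonneg (Finset.sum_nonneg fun j _ => add_nonneg (ih _) (ih _)) (by positivity)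

/-- `Σ_x pₙ(x) = 1` (`d ≥ 1`). [folklore] -/
theorem hasSum_srwLaw (hd : 1 ≤ d) (n : ℕ) : HasSum (srwLaw d n) 1 := by
  have hd' : (0 : ℝ) < d := by exact_mod_cast hd
  induction n with
  | zero => exact hasSum_ite_eq (0 : Site d) (1 : ℝ)
  | succ n ih =>
    have h1 : ∀ j : Fin d, HasSum (fun x : Site d => srwLaw d n (x + Pi.single j 1)) 1 := by
      intro j
      have h := ((Equiv.addRight (Pi.single j (1 : ℤ) : Site d)).hasSum_iff (f := srwLaw d n)).2 ih
      simpa only [Function.comp_def, Equiv.coe_addRight] using h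
    have h2 : ∀ j : Fin d, HasSum (fun x : Site d => srwLaw d n (x - Pi.single j 1)) 1 := by
      intro j
      have h := ((Equiv.subRight (Pi.single j (1 : ℤ) : Site d)).hasSum_iff (f := srwLaw d n)).2 ih
      simpa only [Function.comp_def, Equiv.subRight_apply] using h
    have h3 : HasSum (fun x : Site d =>
        ∑ j : Fin d, (srwLaw d n (x + Pi.single j 1) + srwLaw d n (x - Pi.single j 1)))
        (∑ _j : Fin d, ((1 : ℝ) + 1)) :=
      hasSum_sum fun j _ => (h1 j).add (h2 j)
    have h4 := h3.div_const (2 * (d : ℝ))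
    have e : (∑ _j : Fin d, ((1 : ℝ) + 1)) / (2 * d) = 1 := by
      rw [Finset.sum_const, Finset.card_univ, Fintype.card_fin, nsmul_eq_mul]
      field_simp
      norm_num
    rw [e] at h4
    exact h4

/-- `pₙ(x) ≤ 1` (`d ≥ 1`). [folklore] -/
theorem srwLaw_le_one (hd : 1 ≤ d) (n : ℕ) (x : Site d) : srwLaw d n x ≤ 1 :=
  le_hasSum (hasSum_srwLaw hd n) x fun y _ => srwLaw_nonneg n y

/-- `p₁(0) = 0` (the walk cannot return in one step). [folklore] -/
theorem srwLaw_one_zero : srwLaw d 1 0 = 0 := by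
  rw [srwLaw_succ_apply]
  have h : ∀ j : Fin d, srwLaw d 0 (0 + Pi.single j 1) + srwLaw d 0 (0 - Pi.single j 1) = 0 := by
    intro j
    have hne : (Pi.single j (1 : ℤ) : Site d) ≠ 0 := by
      intro h0
      have := congr_fun h0 j
      simp at this
    rw [srwLaw_zero_apply, srwLaw_zero_apply, zero_add, zero_sub, if_neg hne,
      if_neg (neg_ne_zero.2 hne), add_zero]
  rw [Finset.sum_eq_zero fun j _ => h j, zero_div]

/-- `p_{|x|₁}(x) > 0`: the walk reaches `x` in `|x|₁` steps with positive probability (`d ≥ 1`).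
[folklore] -/
theorem srwLaw_pos_of_sum_abs_eq (hd : 1 ≤ d) (m : ℕ) :
    ∀ x : Site d, ∑ j, |x j| = (m : ℤ) → 0 < srwLaw d m x := by
  have hd' : (0 : ℝ) < 2 * d := by
    have : (0 : ℝ) < d := by exact_mod_cast hd
    linarith
  induction m with
  | zero =>
    intro x hx
    have hx0 : x = 0 := by
      funext j
      have := (Finset.sum_eq_zero_iff_of_nonneg fun i _ => abs_nonneg (x i)).1
        (by exact_mod_cast hx) j (Finset.mem_univ j)
      exact abs_eq_zero.1 this
    subst hx0
    simp [srwLaw_zero_apply]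
  | succ m ih =>
    intro x hx
    -- some coordinate is nonzero
    obtain ⟨j, hj⟩ : ∃ j, x j ≠ 0 := by
      by_contra hall
      push Not at hall
      have : ∑ j, |x j| = 0 := Finset.sum_eq_zero fun j _ => by rw [hall j, abs_zero]
      rw [this] at hx
      exact absurd hx (by positivity)
    have hsplit : ∀ y : Site d, ∑ i, |y i| = |y j| + ∑ i ∈ Finset.univ.erase j, |y i| :=
      fun y => (Finset.add_sum_erase _ _ (Finset.mem_univ j)).symm
    have hrest : ∀ (s : ℤ), ∑ i ∈ Finset.univ.erase j, |(x - Pi.single j s : Site d) i| =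
        ∑ i ∈ Finset.univ.erase j, |x i| := by
      intro s
      refine Finset.sum_congr rfl fun i hi => ?_
      rw [Pi.sub_apply, Pi.single_eq_of_ne (Finset.ne_of_mem_erase hi), sub_zero]
    rw [srwLaw_succ_apply]
    refine div_pos ?_ hd'
    rcases lt_or_gt_of_ne hj with hneg | hpos
    · -- step `+e_j`: `y = x + e_j` is closer
      have hy : ∑ i, |(x + Pi.single j 1 : Site d) i| = (m : ℤ) := by
        have e1 : (x + Pi.single j 1 : Site d) = x - Pi.single j (-1) := by
          rw [sub_eq_add_neg, ← Pi.single_neg, neg_neg]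
        rw [e1, hsplit, hrest, Pi.sub_apply, Pi.single_eq_same]
        have h1 : |x j - -1| = |x j| - 1 := by
          rw [abs_of_neg hneg, abs_of_nonpos (by omega)]
          ring
        rw [h1]
        have := hsplit x
        push_cast at hx ⊢
        linarith
      have hpos' := ih _ hy
      calc 0 < srwLaw d m (x + Pi.single j 1) + srwLaw d m (x - Pi.single j 1) :=
            add_pos_of_pos_of_nonneg hpos' (srwLaw_nonneg _ _)
        _ ≤ ∑ j' : Fin d, (srwLaw d m (x + Pi.single j' 1) + srwLaw d m (x - Pi.single j' 1)) :=
            Finset.single_le_sum (f := fun j' : Fin d =>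
              srwLaw d m (x + Pi.single j' 1) + srwLaw d m (x - Pi.single j' 1))
              (fun j' _ => add_nonneg (srwLaw_nonneg _ _) (srwLaw_nonneg _ _)) (Finset.mem_univ j)
    · -- step `-e_j`
      have hy : ∑ i, |(x - Pi.single j 1 : Site d) i| = (m : ℤ) := by
        rw [hsplit, hrest, Pi.sub_apply, Pi.single_eq_same]
        have h1 : |x j - 1| = |x j| - 1 := by
          rw [abs_of_pos hpos, abs_of_nonneg (by omega)]
        rw [h1]
        have := hsplit x
        push_cast at hx ⊢
        linarith
      have hpos' := ih _ hy
      calc 0 < srwLaw d m (x + Pi.single j 1) + srwLaw d m (x - Pi.single j 1) :=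
            add_pos_of_nonneg_of_pos (srwLaw_nonneg _ _) hpos'
        _ ≤ ∑ j' : Fin d, (srwLaw d m (x + Pi.single j' 1) + srwLaw d m (x - Pi.single j' 1)) :=
            Finset.single_le_sum (f := fun j' : Fin d =>
              srwLaw d m (x + Pi.single j' 1) + srwLaw d m (x - Pi.single j' 1))
              (fun j' _ => add_nonneg (srwLaw_nonneg _ _) (srwLaw_nonneg _ _)) (Finset.mem_univ j)

/-- For `x ≠ 0` some `pₙ(x)`, `n ≥ 1`, is positive (`d ≥ 1`). [folklore] -/
theorem exists_srwLaw_pos (hd : 1 ≤ d) {x : Site d} (hx : x ≠ 0) :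
    ∃ n : ℕ, 1 ≤ n ∧ 0 < srwLaw d n x := by
  obtain ⟨m, hm⟩ : ∃ m : ℕ, ∑ j, |x j| = (m : ℤ) :=
    ⟨(∑ j, |x j|).toNat, (Int.toNat_of_nonneg (Finset.sum_nonneg fun j _ => abs_nonneg _)).symm⟩
  refine ⟨m, ?_, srwLaw_pos_of_sum_abs_eq hd m x hm⟩
  by_contra h0
  have hm0 : m = 0 := by omega
  subst hm0
  apply hx
  funext j
  have := (Finset.sum_eq_zero_iff_of_nonneg fun i _ => abs_nonneg (x i)).1
    (by exact_mod_cast hm) j (Finset.mem_univ j)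
  exact abs_eq_zero.1 this

/-! ### Fourier representation: `(2π)^{-d}∫_{[-π,π]^d} μ(k)ⁿ cos(k·x) dk = pₙ(x)` -/

/-- The phase `k·x = Σ_j k_j x_j` for `x ∈ ℤ^d`. [cite: Slade2017, §2.1.1] -/
def phase (k : Fin d → ℝ) (x : Site d) : ℝ := ∑ j, k j * (x j : ℝ)

/-- `k ↦ k·x` is continuous. [folklore] -/
theorem continuous_phase (x : Site d) : Continuous fun k : Fin d → ℝ => phase k x := by
  unfold phase
  fun_prop

/-- `k·(x + e_j) = k·x + k_j`. [folklore] -/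
theorem phase_add_single (k : Fin d → ℝ) (x : Site d) (j : Fin d) :
    phase k (x + Pi.single j 1) = phase k x + k j := by
  unfold phase
  have h : ∀ i, k i * (((x + Pi.single j 1 : Site d) i : ℤ) : ℝ) =
      k i * (x i : ℝ) + (if i = j then k j else 0) := by
    intro i
    rw [Pi.add_apply, Pi.single_apply, Int.cast_add]
    split_ifs with hij
    · subst hij; push_cast; ring
    · push_cast; ring
  simp_rw [h]
  rw [Finset.sum_add_distrib, Finset.sum_ite_eq' Finset.univ j, if_pos (Finset.mem_univ j)]

/-- `k·(x - e_j) = k·x - k_j`. [folklore] -/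
theorem phase_sub_single (k : Fin d → ℝ) (x : Site d) (j : Fin d) :
    phase k (x - Pi.single j 1) = phase k x - k j := by
  have h := phase_add_single k (x - Pi.single j 1) j
  rw [sub_add_cancel] at h
  linarith

/-- `∫_{-π}^{π} e^{imt} dt = 2π 𝟙{m = 0}` for an integer `m`. [folklore] -/
theorem setIntegral_cexp_I_mul_int (m : ℤ) :
    ∫ t in Set.Icc (-Real.pi) Real.pi, Complex.exp (Complex.I * ((t : ℂ) * (m : ℂ))) =
      if m = 0 then (2 * Real.pi : ℂ) else 0 := by
  rw [integral_Icc_eq_integral_Ioc,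
    ← intervalIntegral.integral_of_le (by linarith [Real.pi_pos] : -Real.pi ≤ Real.pi)]
  split_ifs with hm
  · subst hm
    simp [two_mul]
  · have hc : Complex.I * (m : ℂ) ≠ 0 := mul_ne_zero Complex.I_ne_zero (by exact_mod_cast hm)
    have key : ∀ t : ℝ, Complex.exp (Complex.I * ((t : ℂ) * (m : ℂ))) =
        Complex.exp (Complex.I * (m : ℂ) * t) := fun t => by ring_nf
    simp_rw [key]
    rw [integral_exp_mul_complex hc]
    have hper : Complex.exp (Complex.I * (m : ℂ) * (Real.pi : ℝ)) =
        Complex.exp (Complex.I * (m : ℂ) * (-Real.pi : ℝ)) := by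
      rw [← mul_inv_eq_one₀ (Complex.exp_ne_zero _), ← Complex.exp_neg, ← Complex.exp_add]
      have : Complex.I * (m : ℂ) * ((Real.pi : ℝ) : ℂ) +
          -(Complex.I * (m : ℂ) * ((-Real.pi : ℝ) : ℂ)) = (m : ℂ) * (2 * Real.pi * Complex.I) := by
        push_cast; ring
      rw [this, Complex.exp_int_mul_two_pi_mul_I]
    rw [hper, sub_self, zero_div]

/-- The Brillouin zone with Lebesgue measure is the product of `d` copies of `[-π,π]`. [folklore] -/
theorem volume_restrict_brillouin (d : ℕ) :
    (volume : Measure (Fin d → ℝ)).restrict (brillouin d) =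
      Measure.pi fun _ : Fin d => (volume : Measure ℝ).restrict (Set.Icc (-Real.pi) Real.pi) := by
  rw [brillouin, volume_pi, Measure.restrict_pi_pi]

/-- **Orthogonality of characters on `[-π,π]^d`**, real form:
`∫_{[-π,π]^d} cos(k·x) dk = (2π)^d 𝟙{x = 0}` for `x ∈ ℤ^d`. [folklore] -/
theorem setIntegral_cos_phase (x : Site d) :
    ∫ k in brillouin d, Real.cos (phase k x) = if x = 0 then (2 * Real.pi) ^ d else 0 := by
  -- complexify
  set G : (Fin d → ℝ) → ℂ := fun k => Complex.exp (Complex.I * (phase k x : ℝ)) with hG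
  have hGcont : Continuous G := by
    simp only [hG]
    exact Complex.continuous_exp.comp (continuous_const.mul
      (Complex.continuous_ofReal.comp (continuous_phase x)))
  have hGint : Integrable G ((volume : Measure (Fin d → ℝ)).restrict (brillouin d)) :=
    hGcont.continuousOn.integrableOn_compact (isCompact_brillouin d)
  have hre : ∀ k, Real.cos (phase k x) = RCLike.re (G k) := by
    intro k
    simp only [hG, RCLike.re_to_complex]
    rw [mul_comm, Complex.exp_ofReal_mul_I_re]
  simp_rw [hre]
  rw [integral_re hGint]
  -- the complex integral factorises
  have hprod : ∀ k, G k = ∏ j, Complex.exp (Complex.I * (((k j : ℝ) : ℂ) * (x j : ℂ))) := by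
    intro k
    simp only [hG, phase]
    rw [← Complex.exp_sum, Complex.ofReal_sum, Finset.mul_sum]
    congr 1
    refine Finset.sum_congr rfl fun j _ => ?_
    push_cast
    ring
  have hint : ∫ k, G k ∂((volume : Measure (Fin d → ℝ)).restrict (brillouin d)) =
      ((if x = 0 then (2 * Real.pi) ^ d else 0 : ℝ) : ℂ) := by
    simp_rw [hprod]
    rw [volume_restrict_brillouin,
      integral_fintype_prod_eq_prod (𝕜 := ℂ)
        (fun j (t : ℝ) => Complex.exp (Complex.I * ((t : ℂ) * (x j : ℂ))))]
    have hj : ∀ j, ∫ t in Set.Icc (-Real.pi) Real.pi,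
        Complex.exp (Complex.I * ((t : ℂ) * (x j : ℂ))) =
          if x j = 0 then (2 * Real.pi : ℂ) else 0 :=
      fun j => setIntegral_cexp_I_mul_int (x j)
    simp_rw [hj]
    split_ifs with hx
    · subst hx
      simp
    · obtain ⟨j, hj⟩ : ∃ j, x j ≠ 0 := by
        by_contra h
        push Not at h
        exact hx (funext h)
      rw [Finset.prod_eq_zero (Finset.mem_univ j) (if_neg hj)]
      simp
  rw [hint]
  simp only [RCLike.re_to_complex, Complex.ofReal_re]

/-- Continuous functions are integrable on the Brillouin zone. [folklore] -/
theorem integrableOn_brillouin_of_continuous {f : (Fin d → ℝ) → ℝ} (hf : Continuous f) :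
    Integrable f ((volume : Measure (Fin d → ℝ)).restrict (brillouin d)) :=
  hf.continuousOn.integrableOn_compact (isCompact_brillouin d)

/-- **`(2π)^{-d}∫_{[-π,π]^d} μ(k)ⁿ cos(k·x) dk = pₙ(x)`**: the `n`-th power of the symbol of `J/2d`
is the Fourier transform of the `n`-step law (induction on `n`: `μ(k)cos(k·x) =
(2d)⁻¹Σ_j(cos(k·(x+e_j)) + cos(k·(x-e_j)))` and orthogonality at `n = 0`).
[cite: Slade2017, Lemma 2.2.1 (proof: (J/2d)ⁿ)] -/
theorem setIntegral_avgCos_pow_mul_cos (hd : 1 ≤ d) (n : ℕ) (x : Site d) :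
    ∫ k in brillouin d, avgCos d k ^ n * Real.cos (phase k x) =
      (2 * Real.pi) ^ d * srwLaw d n x := by
  have hd' : (0 : ℝ) < d := by exact_mod_cast hd
  induction n generalizing x with
  | zero =>
    simp only [pow_zero, one_mul]
    rw [setIntegral_cos_phase, srwLaw_zero_apply]
    split_ifs <;> simp
  | succ n ih =>
    -- pointwise recursion of the integrand
    have hpt : ∀ k : Fin d → ℝ, avgCos d k ^ (n + 1) * Real.cos (phase k x) =
        (∑ j, (avgCos d k ^ n * Real.cos (phase k (x + Pi.single j 1)) +
          avgCos d k ^ n * Real.cos (phase k (x - Pi.single j 1)))) / (2 * d) := by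
      intro k
      have hcs : ∀ j : Fin d, Real.cos (phase k (x + Pi.single j 1)) +
          Real.cos (phase k (x - Pi.single j 1)) = 2 * Real.cos (k j) * Real.cos (phase k x) := by
        intro j
        rw [phase_add_single, phase_sub_single, Real.cos_add, Real.cos_sub]
        ring
      have h2 : ∀ j : Fin d, avgCos d k ^ n * Real.cos (phase k (x + Pi.single j 1)) +
          avgCos d k ^ n * Real.cos (phase k (x - Pi.single j 1)) =
          (2 * avgCos d k ^ n * Real.cos (phase k x)) * Real.cos (k j) := by
        intro j
        rw [← mul_add, hcs]
        ring
      simp_rw [h2]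
      rw [← Finset.mul_sum]
      have hS : ∑ j, Real.cos (k j) = d * avgCos d k := by
        unfold avgCos
        field_simp
      rw [hS]
      field_simp
      ring
    simp_rw [hpt]
    rw [integral_div]
    have hintg : ∀ y : Site d, Integrable (fun k => avgCos d k ^ n * Real.cos (phase k y))
        ((volume : Measure (Fin d → ℝ)).restrict (brillouin d)) := fun y =>
      integrableOn_brillouin_of_continuous
        ((continuous_avgCos.pow n).mul (Real.continuous_cos.comp (continuous_phase y)))
    have hI : ∫ k in brillouin d, (∑ j, (avgCos d k ^ n * Real.cos (phase k (x + Pi.single j 1)) +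
          avgCos d k ^ n * Real.cos (phase k (x - Pi.single j 1)))) =
        ∑ j, ∫ k in brillouin d, (avgCos d k ^ n * Real.cos (phase k (x + Pi.single j 1)) +
          avgCos d k ^ n * Real.cos (phase k (x - Pi.single j 1))) :=
      integral_finsetSum Finset.univ fun j _ =>
        (hintg (x + Pi.single j 1)).add (hintg (x - Pi.single j 1))
    rw [hI]
    have hj : ∀ j : Fin d, ∫ k in brillouin d,
        (avgCos d k ^ n * Real.cos (phase k (x + Pi.single j 1)) +
          avgCos d k ^ n * Real.cos (phase k (x - Pi.single j 1))) =
        (2 * Real.pi) ^ d * (srwLaw d n (x + Pi.single j 1) + srwLaw d n (x - Pi.single j 1)) := by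
      intro j
      rw [integral_add (hintg (x + Pi.single j 1)) (hintg (x - Pi.single j 1)), ih, ih]
      ring
    simp_rw [hj]
    rw [← Finset.mul_sum, srwLaw_succ_apply]
    ring

/-! ### The series representation `((-Δ)^β)_{x,y} = (2d)^β Σ_n (-1)ⁿ(β choose n) pₙ(x - y)` -/

/-- **The binomial series of the fractional Laplacian** (the first display in the proof of
Lemma 2.2.1, `(-Δ)^β = (2d)^β Σ_n (β choose n)(-1)ⁿ (J/2d)ⁿ`, entrywise): for `d ≥ 1` and
`0 < β < 1`, `((-Δ)^β)_{x,y} = (2d)^β Σ_n (-1)ⁿ (β choose n) pₙ(x - y)`, obtained from the Fourier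
integral defining `fracLaplacianZd` by expanding `λ(k)^β = (2d)^β(1 - μ(k))^β` in the binomial
series (valid for a.e. `k`, `|μ(k)| < 1` off the corners) and integrating term by term (dominated
convergence, `Σ_n |(β choose n)| < ∞`). [cite: Slade2017, Lemma 2.2.1 (proof, first display)] -/
theorem hasSum_fracLaplacianZd (hd : 1 ≤ d) {β : ℝ} (hβ0 : 0 < β) (hβ1 : β < 1) (x y : Site d) :
    HasSum (fun n => (2 * d : ℝ) ^ β * binomAlt β n * srwLaw d n (x - y))
      (fracLaplacianZd d β x y) := by
  have hd' : (0 : ℝ) < d := by exact_mod_cast hd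
  have h2d : (0 : ℝ) ≤ 2 * d := by positivity
  set μQ : Measure (Fin d → ℝ) := (volume : Measure (Fin d → ℝ)).restrict (brillouin d) with hμQ
  -- the phase of `fracLaplacianZd` is `k·(x - y)`
  have hcos : ∀ k : Fin d → ℝ, Real.cos (∑ j, k j * ((x j : ℝ) - (y j : ℝ))) =
      Real.cos (phase k (x - y)) := by
    intro k
    unfold phase
    congr 1
    refine Finset.sum_congr rfl fun j _ => ?_
    rw [Pi.sub_apply, Int.cast_sub]
  set F : ℕ → (Fin d → ℝ) → ℝ := fun n k =>
    (2 * d : ℝ) ^ β * (binomAlt β n * avgCos d k ^ n) * Real.cos (phase k (x - y)) with hF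
  set f : (Fin d → ℝ) → ℝ := fun k => laplaceSymbol k ^ β * Real.cos (phase k (x - y)) with hf
  -- dominated convergence for the series
  have hDC : HasSum (fun n => ∫ k, F n k ∂μQ) (∫ k, f k ∂μQ) := by
    refine hasSum_integral_of_dominated_convergence
      (bound := fun n _ => (2 * d : ℝ) ^ β * |binomAlt β n|) (fun n => ?_) (fun n => ?_) ?_ ?_ ?_
    · refine Continuous.aestronglyMeasurable ?_
      simp only [hF]
      exact (continuous_const.mul (continuous_const.mul (continuous_avgCos.pow n))).mul
        (Real.continuous_cos.comp (continuous_phase _))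
    · refine Filter.Eventually.of_forall fun k => ?_
      simp only [hF]
      rw [Real.norm_eq_abs, abs_mul, abs_mul, abs_mul, abs_of_nonneg (Real.rpow_nonneg h2d β),
        abs_pow]
      have h1 : |avgCos d k| ^ n ≤ 1 := pow_le_one₀ (abs_nonneg _) (abs_avgCos_le_one k)
      have h2 : |Real.cos (phase k (x - y))| ≤ 1 := Real.abs_cos_le_one _
      have h3 : 0 ≤ (2 * d : ℝ) ^ β * |binomAlt β n| := by positivity
      calc (2 * d : ℝ) ^ β * (|binomAlt β n| * |avgCos d k| ^ n) * |Real.cos (phase k (x - y))|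
          ≤ (2 * d : ℝ) ^ β * (|binomAlt β n| * 1) * 1 := by gcongr
        _ = (2 * d : ℝ) ^ β * |binomAlt β n| := by ring
    · exact Filter.Eventually.of_forall fun k => (summable_abs_binomAlt hβ0 hβ1).mul_left _
    · exact integrableOn_brillouin_of_continuous continuous_const
    · filter_upwards [abs_avgCos_lt_one_ae hd] with k hk
      simp only [hF, hf]
      have hser := ((hasSum_binomAlt_mul_pow β hk).mul_left ((2 * d : ℝ) ^ β)).mul_right
        (Real.cos (phase k (x - y)))
      have hlam : (2 * d : ℝ) ^ β * (1 - avgCos d k) ^ β = laplaceSymbol k ^ β := by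
        rw [laplaceSymbol_eq_avgCos hd, Real.mul_rpow h2d]
        linarith [abs_le.1 (abs_avgCos_le_one k)]
      rw [hlam] at hser
      exact hser
  -- evaluate the terms
  have hFn : ∀ n, ∫ k, F n k ∂μQ =
      (2 * d : ℝ) ^ β * binomAlt β n * ((2 * Real.pi) ^ d * srwLaw d n (x - y)) := by
    intro n
    simp only [hF, hμQ]
    rw [← setIntegral_avgCos_pow_mul_cos hd n (x - y), ← integral_const_mul]
    congr 1
    funext k
    ring
  simp_rw [hFn] at hDC
  -- and compare with the definition of `fracLaplacianZd`
  have hK : fracLaplacianZd d β x y = ((2 * Real.pi) ^ d)⁻¹ * ∫ k, f k ∂μQ := by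
    unfold fracLaplacianZd
    simp only [hf, hμQ, hcos]
  rw [hK]
  have hπ : ((2 * Real.pi) ^ d : ℝ) ≠ 0 := by positivity
  have h := hDC.mul_left (((2 * Real.pi) ^ d : ℝ)⁻¹)
  have hfun : (fun n => ((2 * Real.pi) ^ d : ℝ)⁻¹ *
      ((2 * d : ℝ) ^ β * binomAlt β n * ((2 * Real.pi) ^ d * srwLaw d n (x - y)))) =
      fun n => (2 * d : ℝ) ^ β * binomAlt β n * srwLaw d n (x - y) := by
    funext n
    field_simp
  rw [hfun] at h
  exact h

/-- The diagonal coefficient: `a₁ = -β`. [folklore] -/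
theorem binomAlt_one (β : ℝ) : binomAlt β 1 = -β := by
  have := binomAlt_succ β 0
  simp [binomPartialProd] at this
  rw [this]

/-- **Lemma 2.2.1, diagonal**: `((-Δ)^β)_{x,x} > 0` (`d ≥ 1`, `0 < β < 1`); in fact
`((-Δ)^β)_{x,x} ≥ β(2d)^β`, comparing the series with `(2d)^β(Σ_n a_n - a₁)` using `a_n ≤ 0`
(`n ≥ 1`), `pₙ(0) ≤ 1`, `p₁(0) = 0`. [cite: Slade2017, Lemma 2.2.1] -/
theorem fracLaplacianZd_self_pos (hd : 1 ≤ d) {β : ℝ} (hβ0 : 0 < β) (hβ1 : β < 1) (x : Site d) :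
    0 < fracLaplacianZd d β x x := by
  have hd' : (0 : ℝ) < d := by exact_mod_cast hd
  have hc : (0 : ℝ) < (2 * d : ℝ) ^ β := Real.rpow_pos_of_pos (by positivity) β
  have hK := hasSum_fracLaplacianZd hd hβ0 hβ1 x x
  rw [sub_self] at hK
  -- comparison series
  set g : ℕ → ℝ := fun n => (2 * d : ℝ) ^ β * (binomAlt β n - if n = 1 then binomAlt β 1 else 0)
    with hg
  have hgs : HasSum g ((2 * d : ℝ) ^ β * (0 - binomAlt β 1)) :=
    ((hasSum_binomAlt hβ0 hβ1).sub (hasSum_ite_eq 1 (binomAlt β 1))).mul_left _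
  have hle : ∀ n, g n ≤ (2 * d : ℝ) ^ β * binomAlt β n * srwLaw d n 0 := by
    intro n
    simp only [hg]
    rcases n with _ | _ | n
    · simp [binomAlt_zero, srwLaw_zero_apply]
    · simp [srwLaw_one_zero]
    · rw [if_neg (by omega), sub_zero, mul_assoc]
      refine mul_le_mul_of_nonneg_left ?_ hc.le
      have ha : binomAlt β (n + 1 + 1) ≤ 0 := (binomAlt_succ_neg hβ0 hβ1 (n + 1)).le
      have hW : srwLaw d (n + 1 + 1) 0 ≤ 1 := srwLaw_le_one hd _ _
      nlinarith
  have := hasSum_le hle hgs hK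
  rw [binomAlt_one] at this
  nlinarith

/-- **Lemma 2.2.1, off-diagonal**: `((-Δ)^β)_{x,y} < 0` for `x ≠ y` (`d ≥ 1`, `0 < β < 1`): every
term `(2d)^β a_n pₙ(x-y)` of the series is `≤ 0` (`a_0 p_0(x-y) = 0`, `a_n < 0 ≤ pₙ` for
`n ≥ 1`) and the term `n = |x-y|₁` is `< 0`. [cite: Slade2017, Lemma 2.2.1] -/
theorem fracLaplacianZd_neg (hd : 1 ≤ d) {β : ℝ} (hβ0 : 0 < β) (hβ1 : β < 1) {x y : Site d}
    (hxy : y ≠ x) : fracLaplacianZd d β x y < 0 := by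
  have hd' : (0 : ℝ) < d := by exact_mod_cast hd
  have hc : (0 : ℝ) < (2 * d : ℝ) ^ β := Real.rpow_pos_of_pos (by positivity) β
  have hK := hasSum_fracLaplacianZd hd hβ0 hβ1 x y
  have hz : x - y ≠ 0 := sub_ne_zero.2 (Ne.symm hxy)
  obtain ⟨n₀, hn₀, hpos⟩ := exists_srwLaw_pos hd hz
  have hle : ∀ n, (2 * d : ℝ) ^ β * binomAlt β n * srwLaw d n (x - y) ≤ 0 := by
    intro n
    rcases n with _ | n
    · simp [srwLaw_zero_apply, hz]
    · rw [mul_assoc]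
      exact mul_nonpos_of_nonneg_of_nonpos hc.le
        (mul_nonpos_of_nonpos_of_nonneg (binomAlt_succ_neg hβ0 hβ1 n).le (srwLaw_nonneg _ _))
  have hlt : (2 * d : ℝ) ^ β * binomAlt β n₀ * srwLaw d n₀ (x - y) < 0 := by
    obtain ⟨m, rfl⟩ : ∃ m, n₀ = m + 1 := ⟨n₀ - 1, by omega⟩
    rw [mul_assoc]
    exact mul_neg_of_pos_of_neg hc (mul_neg_of_neg_of_pos (binomAlt_succ_neg hβ0 hβ1 m) hpos)
  have := hasSum_lt (f := fun n => (2 * d : ℝ) ^ β * binomAlt β n * srwLaw d n (x - y))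
    (g := fun _ => (0 : ℝ)) hle hlt hK hasSum_zero
  exact this

/-- The double family `(n, z) ↦ (2d)^β a_n pₙ(z)` is absolutely summable:
`Σ_n Σ_z (2d)^β|a_n|pₙ(z) = (2d)^β Σ_n |a_n| < ∞`. [folklore] -/
theorem summable_abs_series_family (hd : 1 ≤ d) {β : ℝ} (hβ0 : 0 < β) (hβ1 : β < 1) :
    Summable fun p : ℕ × Site d => |(2 * d : ℝ) ^ β * binomAlt β p.1 * srwLaw d p.1 p.2| := by
  have hd' : (0 : ℝ) < d := by exact_mod_cast hd
  have hc : (0 : ℝ) ≤ (2 * d : ℝ) ^ β := Real.rpow_nonneg (by positivity) β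
  have habs : ∀ p : ℕ × Site d, |(2 * d : ℝ) ^ β * binomAlt β p.1 * srwLaw d p.1 p.2| =
      (2 * d : ℝ) ^ β * |binomAlt β p.1| * srwLaw d p.1 p.2 := by
    intro p
    rw [abs_mul, abs_mul, abs_of_nonneg hc, abs_of_nonneg (srwLaw_nonneg _ _)]
  simp_rw [habs]
  refine (summable_prod_of_nonneg fun p =>
    mul_nonneg (mul_nonneg hc (abs_nonneg _)) (srwLaw_nonneg _ _)).2 ⟨fun n => ?_, ?_⟩
  · dsimp only
    exact (hasSum_srwLaw hd n).summable.mul_left _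
  · simp only
    have h : ∀ n, ∑' z : Site d, (2 * d : ℝ) ^ β * |binomAlt β n| * srwLaw d n z =
        (2 * d : ℝ) ^ β * |binomAlt β n| := by
      intro n
      rw [tsum_mul_left, (hasSum_srwLaw hd n).tsum_eq, mul_one]
    simp_rw [h]
    exact (summable_abs_binomAlt hβ0 hβ1).mul_left _

/-- **Lemma 2.2.1, row sums**: `Σ_{y∈ℤ^d} ((-Δ)^β)_{x,y} = 0` (`d ≥ 1`, `0 < β < 1`), as an
absolutely convergent sum: interchange `Σ_y` and `Σ_n` in the series (Fubini for the absolutely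
summable double family) and use `Σ_y pₙ(x - y) = 1`, `Σ_n a_n = 0` — "`Σ_n (-1)ⁿ(β choose n) =
(1 - 1)^β = 0`". [cite: Slade2017, Lemma 2.2.1 (proof, last display)] -/
theorem hasSum_fracLaplacianZd_row (hd : 1 ≤ d) {β : ℝ} (hβ0 : 0 < β) (hβ1 : β < 1) (x : Site d) :
    HasSum (fun y : Site d => fracLaplacianZd d β x y) 0 := by
  set G : ℕ × Site d → ℝ := fun p => (2 * d : ℝ) ^ β * binomAlt β p.1 * srwLaw d p.1 p.2 with hG
  have hGs : Summable G := (summable_abs_series_family hd hβ0 hβ1).of_abs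
  -- total sum is `0`: sum over `z` first
  have hG0 : HasSum G 0 := by
    have h1 : HasSum (fun n => ∑' z : Site d, G (n, z)) (∑' p, G p) :=
      hGs.hasSum.prod_fiberwise fun n => (hGs.comp_injective (Prod.mk_right_injective n)).hasSum
    have h2 : ∀ n, ∑' z : Site d, G (n, z) = (2 * d : ℝ) ^ β * binomAlt β n := by
      intro n
      simp only [hG]
      rw [tsum_mul_left, (hasSum_srwLaw hd n).tsum_eq, mul_one]
    simp_rw [h2] at h1
    have h3 : HasSum (fun n => (2 * d : ℝ) ^ β * binomAlt β n) ((2 * d : ℝ) ^ β * 0) :=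
      (hasSum_binomAlt hβ0 hβ1).mul_left _
    rw [mul_zero] at h3
    rw [← h1.unique h3]
    exact hGs.hasSum
  -- now sum over `n` first
  have hG0' : HasSum (fun q : Site d × ℕ => G q.swap) 0 := by
    have hs' : Summable fun q : Site d × ℕ => G q.swap := hGs.prod_symm
    have htot : ∑' q : Site d × ℕ, G q.swap = ∑' p, G p :=
      (Equiv.prodComm (Site d) ℕ).tsum_eq G
    rw [← hG0.tsum_eq, ← htot]
    exact hs'.hasSum
  have hfib : ∀ z : Site d, HasSum (fun n => G (z, n).swap) (fracLaplacianZd d β x (x - z)) := by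
    intro z
    have h := hasSum_fracLaplacianZd hd hβ0 hβ1 x (x - z)
    rw [sub_sub_cancel] at h
    exact h
  have hz : HasSum (fun z : Site d => fracLaplacianZd d β x (x - z)) 0 := hG0'.prod_fiberwise hfib
  exact (Equiv.subLeft x).hasSum_iff.1 hz

/-- **Slade, Lemma 2.2.1, PROVED** (discharging the named fact `Slade2017_lem221` of the sibling
file): for `d ≥ 1` and `β ∈ (0,1)`, `((-Δ)^β)_{x,x} > 0`, `((-Δ)^β)_{x,y} < 0` for `x ≠ y`, and
`Σ_y ((-Δ)^β)_{x,y} = 0` — "`-(-Δ)^β` generates a Markov chain on `ℤ^d`". The printed proof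
expands `(-Δ)^β = (2d)^β(I - J/2d)^β` in the binomial series; here this is carried out on the
Fourier side for the transcribed kernel `fracLaplacianZd` (`hasSum_fracLaplacianZd`).
[cite: Slade2017, Lemma 2.2.1] -/
theorem Slade2017_lem221_holds : Slade2017_lem221 := by
  intro d hd β hβ0 hβ1 x
  exact ⟨fracLaplacianZd_self_pos hd hβ0 hβ1 x, fun y hy => fracLaplacianZd_neg hd hβ0 hβ1 hy,
    hasSum_fracLaplacianZd_row hd hβ0 hβ1 x⟩

/-! ### Consequences: summability of the kernel, the torus generator, Lemma 8.2.1 unconditionally -/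

/-- **Rows of `(-Δ)^β` are absolutely summable** (`d ≥ 1`, `0 < β < 1`): the summability half of
Lemma 2.1.1 that makes the periodised torus kernel a genuine sum (the decay RATE
`|x|^{-d-2β}` of Lemma 2.1.1 is not proved here). From the one-signedness of the off-diagonal
entries and the convergence of the row sum. [cite: Slade2017, Lemma 2.1.1 and §2.2.2] -/
theorem summable_abs_fracLaplacianZd (hd : 1 ≤ d) {β : ℝ} (hβ0 : 0 < β) (hβ1 : β < 1)
    (x : Site d) : Summable fun y : Site d => |fracLaplacianZd d β x y| := by
  have hrow := (hasSum_fracLaplacianZd_row hd hβ0 hβ1 x).summable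
  have h : ∀ y, |fracLaplacianZd d β x y| =
      -fracLaplacianZd d β x y + (if y = x then 2 * fracLaplacianZd d β x x else 0) := by
    intro y
    by_cases hy : y = x
    · subst hy
      rw [if_pos rfl, abs_of_pos (fracLaplacianZd_self_pos hd hβ0 hβ1 y)]
      ring
    · rw [if_neg hy, add_zero, abs_of_neg (fracLaplacianZd_neg hd hβ0 hβ1 hy)]
  simp_rw [h]
  exact hrow.neg.add (hasSum_ite_eq x _).summable

/-- The periodisation family `z ↦ ((-Δ_{ℤ^d})^β)_{x̃, ỹ+Mz}` defining the torus kernel is summable,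
so `fracLaplacianTorus d β M x y` is the genuine sum `Σ_z ((-Δ_{ℤ^d})^β)_{x̃,ỹ+Mz}` ("Summability of
the right-hand side is guaranteed by Lemma 2.1.1", §2.2.2) — for `d ≥ 1`, `β ∈ (0,1)`, `M ≥ 1`.
[cite: Slade2017, §2.2.2] -/
theorem hasSum_fracLaplacianTorus (hd : 1 ≤ d) {β : ℝ} (hβ0 : 0 < β) (hβ1 : β < 1) {M : ℕ}
    [NeZero M] (x y : TorusSite d M) :
    HasSum (fun z : Site d => fracLaplacianZd d β (fun j => ((x j).val : ℤ))
      (fun j => ((y j).val : ℤ) + M * z j)) (fracLaplacianTorus d β M x y) := by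
  have hrow := (hasSum_fracLaplacianZd_row hd hβ0 hβ1 (fun j => ((x j).val : ℤ))).summable
  have hinj : Function.Injective
      fun z : Site d => (fun j => ((y j).val : ℤ) + M * z j : Site d) := by
    intro z₁ z₂ h
    funext j
    have hj := congr_fun h j
    simpa [NeZero.ne M] using hj
  have hs := hrow.comp_injective hinj
  unfold fracLaplacianTorus
  exact hs.hasSum

/-- **The torus fractional Laplacian has vanishing row sums**, unconditionally (`d ≥ 1`,
`β ∈ (0,1)`, any period `M ≥ 1`). [cite: Slade2017, §2.2.2 (torus generator) and Lemma 2.2.1] -/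
theorem fracLaplacianTorus_rowSum (hd : 1 ≤ d) {β : ℝ} (hβ0 : 0 < β) (hβ1 : β < 1) {M : ℕ}
    [NeZero M] (x : TorusSite d M) : ∑ y, fracLaplacianTorus d β M x y = 0 :=
  fracLaplacianTorus_rowSum_of_lem221 Slade2017_lem221_holds hd hβ0 hβ1 x

/-- **Slade, Lemma 8.2.1, unconditionally** for the transcribed long-range model: `d ≥ 1`,
`α ∈ (0,2)`, any torus period `M ≥ 1`, component `i`, `g > 0`, `m² > 0`, `ν₀ ∈ ℝ`.
[cite: Slade2017, Lemma 8.2.1] -/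
theorem Slade2017_lem821_unconditional {M n : ℕ} [NeZero M] (hd : 1 ≤ d) (i : Fin n)
    {α g ν₀ m2 : ℝ} (hα0 : 0 < α) (hα2 : α < 2) (hg : 0 < g) (hm2 : 0 < m2) :
    torusSusceptibility d M n α g (ν₀ + m2) =
      1 / m2 + 1 / m2 ^ 2 * (1 / Fintype.card (TorusSite d M)) *
        (iteratedDeriv 2 (fun t : ℝ => gaussConvZ0 d M n α g ν₀ m2 (t • unitField d M n i)) 0 /
          gaussConvZ0 d M n α g ν₀ m2 0) :=
  Slade2017_lem821_of_lem221 Slade2017_lem221_holds hd i hα0 hα2 hg hm2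

end LongRangePhi4

end Literature.Barriers.CriticalPhenomena

end
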